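import Summits.CriticalPhenomena.PercolationContinuityZ3.Theorems.PercNearOneGluingNoHeavyLowerTailSunflowerAntipodalGladkov
import Mathlib.Analysis.SpecialFunctions.Pow.Real
import HarnessLib

/-!
# `NoHeavyLowerTail` (crux stmt-CriticalPhenomena-4575), abstract sunflower cubic: the WEIGHTED (size-biased / two-measure) antipodal Gladkov
# inequality

Support file (seat `prim-ineq-prove-1` gen 26; `--supports stmt-CriticalPhenomena-4575`; companion of `…SunflowerAntipodalGladkov` (p214186)).
Memo: run/shared/lean/prim/prim-ineq-prove-1/FINDING-MUIR-prove1-g26.md §2 (the `(1,1,0)` edge of the size-biased partition inequality `★_w`)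
and §4 (two-measure / proportional-odds form).

THEOREM (`weighted_antipodal_sum_nonneg`, this work).  For a monotone map `lab : 2^α → M₃` (a `Sunflower`), real weights `a ≥ b ≥ 0`, every
finite `W` and nested offsets `G₂ ⊆ G₁`:
  `0 ≤ Σ_{S ⊆ W} a^{|S|} b^{|W∖S|} · kk (lab (G₁ ∪ S)) (lab (G₂ ∪ (W ∖ S)))`.
The case `a = b = 1` is `Sunflower.antipodal_sum_nonneg` (p214186).  Proof: the same one-coordinate induction; exposing `e` produces the two terms
`a·kk s¹ t⁰ + b·kk s⁰ t¹` over each `S ⊆ W ∖ e`, and since `a ≥ b` the submodularity `kk s⁰t⁰ + kk s¹t¹ ≤ kk s¹t⁰ + kk s⁰t¹` (`kk_submod`) gives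
`≥ b·(kk s⁰t⁰ + kk s¹t¹) + (a−b)·kk s¹t⁰`, i.e. `b`·[instance `(G₁,G₂)`] + `b`·[instance `(G₁+e,G₂+e)`] + `(a−b)`·[instance `(G₁+e,G₂)`], all three with nested
offsets — the heavier weight must sit on the side of the higher offset, which is why the class {`a ≥ b`, `G₂ ⊆ G₁`} is the inductively closed one.
COROLLARY (`weighted_antipodal_gladkov`): with no offsets the sum is symmetric under `S ↦ W ∖ S`, so it is `≥ 0` for ALL `a, b ≥ 0`:
the antipodal Gladkov inequality holds for every size-biased split `P(e ∈ S) = a/(a+b)` (equivalently, by the sparse limit, Gladkov's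
`ab ≥ e₂(c)` polarised across two product measures with proportional odds; the partition inequality `★` under exchangeable block bias `(a,b,0)`).
-/

namespace Summit.CriticalPhenomena.PercolationContinuityZ3.Theorems.SunflowerPartition

open Finset

/-- `kk` is symmetric. [this work] -/
theorem kk_comm : ∀ a b : Fin 5, kk a b = kk b a := by decide

variable {α : Type*} [DecidableEq α]

namespace Sunflower

variable (F : Sunflower α)

/-- **Weighted antipodal Gladkov with offsets** (this work): for real weights `b ≤ a`, `0 ≤ b`, and `G₂ ⊆ G₁`,
`0 ≤ Σ_{S ⊆ W} a^{|S|} b^{|W ∖ S|} kk (lab (G₁ ∪ S)) (lab (G₂ ∪ (W ∖ S)))`. [this work] -/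
theorem weighted_antipodal_sum_nonneg {a b : ℝ} (hb : 0 ≤ b) (hab : b ≤ a) (W : Finset α) :
    ∀ G₁ G₂ : Finset α, G₂ ⊆ G₁ →
      0 ≤ ∑ S ∈ W.powerset, a ^ S.card * b ^ (W \ S).card * (kk (F.lab (G₁ ∪ S)) (F.lab (G₂ ∪ (W \ S))) : ℝ) := by
  have ha : 0 ≤ a := le_trans hb hab
  induction W using Finset.induction_on with
  | empty =>
    intro G₁ G₂ h
    simp only [powerset_empty, sum_singleton, union_empty, sdiff_self, bot_eq_empty, card_empty, pow_zero, one_mul]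
    exact_mod_cast kk_nonneg_of_mle _ _ (F.lab_mono h)
  | insert e W' he ih =>
    intro G₁ G₂ h
    rw [sum_powerset_insert he]
    -- rewrite both families of summands over `S ⊆ W'`
    have hL : ∀ S ∈ W'.powerset,
        a ^ S.card * b ^ (insert e W' \ S).card * (kk (F.lab (G₁ ∪ S)) (F.lab (G₂ ∪ (insert e W' \ S))) : ℝ)
          = b * (a ^ S.card * b ^ (W' \ S).card * (kk (F.lab (G₁ ∪ S)) (F.lab (insert e G₂ ∪ (W' \ S))) : ℝ)) := by
      intro S hS
      have hSW : S ⊆ W' := mem_powerset.1 hS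
      have heS : e ∉ S := fun hx => he (hSW hx)
      have hsd : insert e W' \ S = insert e (W' \ S) := by
        ext x; simp only [mem_sdiff, mem_insert]
        constructor
        · rintro ⟨h1 | h1, h2⟩
          · exact Or.inl h1
          · exact Or.inr ⟨h1, h2⟩
        · rintro (h1 | ⟨h1, h2⟩)
          · exact ⟨Or.inl h1, fun hx => heS (h1 ▸ hx)⟩
          · exact ⟨Or.inr h1, h2⟩
      have hcard : (insert e (W' \ S)).card = (W' \ S).card + 1 :=
        card_insert_of_notMem fun hx => he (mem_sdiff.1 hx).1
      rw [hsd, hcard, union_insert_eq e G₂ (W' \ S), pow_succ]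
      ring
    have hR : ∀ S ∈ W'.powerset,
        a ^ (insert e S).card * b ^ (insert e W' \ insert e S).card
            * (kk (F.lab (G₁ ∪ insert e S)) (F.lab (G₂ ∪ (insert e W' \ insert e S))) : ℝ)
          = a * (a ^ S.card * b ^ (W' \ S).card * (kk (F.lab (insert e G₁ ∪ S)) (F.lab (G₂ ∪ (W' \ S))) : ℝ)) := by
      intro S hS
      have hSW : S ⊆ W' := mem_powerset.1 hS
      have heS : e ∉ S := fun hx => he (hSW hx)
      rw [card_insert_of_notMem heS, insert_sdiff_insert_of_not_mem he, union_insert_eq e G₁ S, pow_succ]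
      ring
    rw [sum_congr rfl hL, sum_congr rfl hR]
    -- pointwise: a·kk s¹t⁰ + b·kk s⁰t¹ ≥ b·kk s⁰t⁰ + b·kk s¹t¹ + (a-b)·kk s¹t⁰
    have key : ∀ S ∈ W'.powerset,
        b * (a ^ S.card * b ^ (W' \ S).card * (kk (F.lab (G₁ ∪ S)) (F.lab (G₂ ∪ (W' \ S))) : ℝ))
          + b * (a ^ S.card * b ^ (W' \ S).card
              * (kk (F.lab (insert e G₁ ∪ S)) (F.lab (insert e G₂ ∪ (W' \ S))) : ℝ))
          + (a - b) * (a ^ S.card * b ^ (W' \ S).card * (kk (F.lab (insert e G₁ ∪ S)) (F.lab (G₂ ∪ (W' \ S))) : ℝ))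
        ≤ b * (a ^ S.card * b ^ (W' \ S).card * (kk (F.lab (G₁ ∪ S)) (F.lab (insert e G₂ ∪ (W' \ S))) : ℝ))
          + a * (a ^ S.card * b ^ (W' \ S).card * (kk (F.lab (insert e G₁ ∪ S)) (F.lab (G₂ ∪ (W' \ S))) : ℝ)) := by
      intro S _
      have h1 := F.lab_mono (union_subset_union (subset_insert e G₁) (subset_refl S))
      have h2 := F.lab_mono (union_subset_union (subset_insert e G₂) (subset_refl (W' \ S)))
      have hsub : (kk (F.lab (G₁ ∪ S)) (F.lab (G₂ ∪ (W' \ S))) : ℝ)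
          + (kk (F.lab (insert e G₁ ∪ S)) (F.lab (insert e G₂ ∪ (W' \ S))) : ℝ)
          ≤ (kk (F.lab (insert e G₁ ∪ S)) (F.lab (G₂ ∪ (W' \ S))) : ℝ)
            + (kk (F.lab (G₁ ∪ S)) (F.lab (insert e G₂ ∪ (W' \ S))) : ℝ) := by
        exact_mod_cast kk_submod _ _ _ _ h1 h2
      have hw : 0 ≤ a ^ S.card * b ^ (W' \ S).card := mul_nonneg (pow_nonneg ha _) (pow_nonneg hb _)
      nlinarith [mul_nonneg hb hw, hw]
    have hsum := sum_le_sum key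
    have ih1 := ih G₁ G₂ h
    have ih2 := ih (insert e G₁) (insert e G₂) (insert_subset_insert e h)
    have ih3 := ih (insert e G₁) G₂ (h.trans (subset_insert e G₁))
    have hab' : 0 ≤ a - b := sub_nonneg.2 hab
    rw [← sum_add_distrib]
    refine le_trans ?_ hsum
    rw [sum_add_distrib, sum_add_distrib, ← mul_sum, ← mul_sum, ← mul_sum]
    exact add_nonneg (add_nonneg (mul_nonneg hb ih1) (mul_nonneg hb ih2)) (mul_nonneg hab' ih3)

/-- **Weighted antipodal Gladkov** (this work): for ALL real weights `a, b ≥ 0`,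
`0 ≤ Σ_{S ⊆ W} a^{|S|} b^{|W ∖ S|} kk (lab S) (lab (W ∖ S))` — the antipodal Gladkov inequality for a size-biased split of `W`
(each coordinate on the first side with probability `a/(a+b)`); for `a < b` reindex `S ↦ W ∖ S`. [this work] -/
theorem weighted_antipodal_gladkov {a b : ℝ} (ha : 0 ≤ a) (hb : 0 ≤ b) (W : Finset α) :
    0 ≤ ∑ S ∈ W.powerset, a ^ S.card * b ^ (W \ S).card * (kk (F.lab S) (F.lab (W \ S)) : ℝ) := by
  rcases le_total b a with hba | hab
  · have h := F.weighted_antipodal_sum_nonneg hb hba W ∅ ∅ subset_rfl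
    simpa only [empty_union] using h
  · have h := F.weighted_antipodal_sum_nonneg ha hab W ∅ ∅ subset_rfl
    simp only [empty_union] at h
    refine le_of_le_of_eq h (sum_bij' (fun S _ => W \ S) (fun S _ => W \ S) ?_ ?_ ?_ ?_ ?_)
    · intro S _; exact mem_powerset.2 sdiff_subset
    · intro S _; exact mem_powerset.2 sdiff_subset
    · intro S hS; exact Finset.sdiff_sdiff_eq_self (mem_powerset.1 hS)
    · intro S hS; exact Finset.sdiff_sdiff_eq_self (mem_powerset.1 hS)
    · intro S hS
      rw [Finset.sdiff_sdiff_eq_self (mem_powerset.1 hS), kk_comm (F.lab (W \ S)) (F.lab S)]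
      ring

end Sunflower

end Summit.CriticalPhenomena.PercolationContinuityZ3.Theorems.SunflowerPartition
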